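import Summits.AnomalousDissipation.AnomalousDissipation.Theorems.QuarticGate.Negative.EnergyRow

/-!
# Negative knowledge for the crux `MomentParity.UniformResolution` (stmt-AnomalousDissipation-14330), I:
# shape of the statement, force floor, the zero force

Certified copy of the vocabulary and sections A–B of the cdisprove work file
`Cruxes/UniformResolution/Disproof.lean` (refuter-cdisprove-stmt-AnomalousDissipation-14330-0, cycle 1).
Supports stmt-AnomalousDissipation-14330; no positive route-item statement is asserted (the crux is an
implication `A → B` over all forces; proved here are its definitional restatement, necessary conditions on
witnesses of `A` and `B`, and the refutation of the strengthening with the antecedent deleted).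

* Vocabulary: `IsResolved`, `IsLoudFamilyAt` (antecedent body at one `ν`), `IsResolvedLoudFamilyAt`
  (conclusion body at one `ν`); `uniformResolution_iff` (`Iff.rfl`).
* (A) SHAPE: `not_uniformResolution_iff`; `DwiseGalerkinInvariantLoud`; `dwise_of_not_uniformResolution` — any
  disproof proves a (d-wise) Galerkin-ensemble zeroth law; `dwise_of_galerkinInvariantLoud`.
* (B) FORCE FLOOR `ε ≤ ‖f‖₂√E` for both bodies (energy row of `QuarticGate.Negative.EnergyRow`); the zero
  force is quiet; `IsLoudFamilyAt.nu_pos` (`0 < ν j` is implied by the antecedent); `not_resolvedLoudEveryForce`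
  (the conclusion for every force — antecedent deleted — is FALSE: the antecedent is load-bearing).
-/

namespace Summit.AnomalousDissipation.AnomalousDissipation.Theorems.UniformResolution.Negative

open MeasureTheory Filter Topology
open scoped ENNReal InnerProductSpace RealInnerProductSpace
open Literature.Analysis.FunctionSpaces Literature.Analysis.FluidPDE
open Summit.AnomalousDissipation.AnomalousDissipation.Theses.MomentParity
open Summit.AnomalousDissipation.AnomalousDissipation.Theorems.QuarticGate.Negative
open Summit.AnomalousDissipation.AnomalousDissipation.Theorems

noncomputable section

/-! ## Vocabulary (verbatim clauses of `UniformResolution`, named) -/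

/-- The `κ`-RESOLUTION clause (verbatim from `UniformResolution` / `MomentLadder`): the mean enstrophy is
carried by the modes `|k| ≤ κ(n)` up to `1/(n+1)`, for every `n`. -/
def IsResolved (κ : ℕ → ℕ) (μ : Measure (Torus.energySpace (Fin 3))) : Prop :=
  ∀ n : ℕ, ∫⁻ u, Torus.eGradNormSq (u.1 : UnitAddTorus (Fin 3) → EuclideanSpace ℝ (Fin 3)) ∂μ ≤
    (∫⁻ u, Torus.eGradNormSq (Torus.fourierTruncate (κ n)
      (u.1 : UnitAddTorus (Fin 3) → EuclideanSpace ℝ (Fin 3))) ∂μ) + ((n : ENNReal) + 1)⁻¹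

/-- The ANTECEDENT of `UniformResolution` at one viscosity value `ν` (budgets `E`, `ε`): a support radius
`R` and, for infinitely many levels `N` and EVERY order `d`, a level-`N` probability law supported in
`‖u‖ ≤ R`, `d`-stationary for Galerkin NS at `(ν, f)`, with mean energy `≤ E` and dissipation `≥ ε`
(the `d`-wise body of `GalerkinInvariantLoud`). -/
def IsLoudFamilyAt (f : UnitAddTorus (Fin 3) → EuclideanSpace ℝ (Fin 3)) (ν E ε : ℝ) : Prop :=
  ∃ R : ℝ, ∃ᶠ N in atTop, ∀ d : ℕ, ∃ μ : Measure (Torus.energySpace (Fin 3)),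
    IsProbabilityMeasure μ ∧ (∀ᵐ u ∂μ, IsLevel N u) ∧ (∀ᵐ u ∂μ, ‖u‖ ≤ R) ∧
    IsPolyStationary ν f N d μ ∧ Torus.ensembleEnergy μ ≤ E ∧ ε ≤ Torus.ensembleDissipation ν μ

/-- The CONCLUSION body of `UniformResolution` at one viscosity value `ν` (budgets `E`, `ε`): the same
with a resolution schedule `κ` uniform in `N` and `d` (the body of `MomentLadder`). -/
def IsResolvedLoudFamilyAt (f : UnitAddTorus (Fin 3) → EuclideanSpace ℝ (Fin 3)) (ν E ε : ℝ) : Prop :=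
  ∃ (R : ℝ) (κ : ℕ → ℕ), ∃ᶠ N in atTop, ∀ d : ℕ, ∃ μ : Measure (Torus.energySpace (Fin 3)),
    IsProbabilityMeasure μ ∧ (∀ᵐ u ∂μ, IsLevel N u) ∧ (∀ᵐ u ∂μ, ‖u‖ ≤ R) ∧ IsResolved κ μ ∧
    IsPolyStationary ν f N d μ ∧ Torus.ensembleEnergy μ ≤ E ∧ ε ≤ Torus.ensembleDissipation ν μ

/-- `UniformResolution` restated through the vocabulary (definitional unfolding, `Iff.rfl`):
for every admissible force, every positive `ν_j → 0` and budgets `E`, `ε > 0`,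
(loud `d`-stationary families at every `j`) → (RESOLVED loud `d`-stationary families at every `j`,
for SOME budgets `E'`, `ε' > 0`). [folklore] -/
theorem uniformResolution_iff :
    UniformResolution ↔ ∀ f : UnitAddTorus (Fin 3) → EuclideanSpace ℝ (Fin 3),
      Torus.IsSmooth f → Torus.IsDivFree f → Torus.HasZeroMean f →
      ∀ (ν : ℕ → ℝ) (E ε : ℝ), (∀ j, 0 < ν j) → Tendsto ν atTop (𝓝 0) → 0 < ε →
      (∀ j : ℕ, IsLoudFamilyAt f (ν j) E ε) →
      ∃ E' ε' : ℝ, 0 < ε' ∧ ∀ j : ℕ, IsResolvedLoudFamilyAt f (ν j) E' ε' :=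
  Iff.rfl

/-! ## A. Shape of the statement: what a refutation must contain -/

section Shape

/-- The conclusion body implies the antecedent body with the SAME budgets (drop `κ`). [folklore] -/
theorem IsResolvedLoudFamilyAt.isLoudFamilyAt {f : UnitAddTorus (Fin 3) → EuclideanSpace ℝ (Fin 3)}
    {ν E ε : ℝ} (h : IsResolvedLoudFamilyAt f ν E ε) : IsLoudFamilyAt f ν E ε := by
  obtain ⟨R, κ, hfreq⟩ := h
  refine ⟨R, hfreq.mono fun N hN d => ?_⟩
  obtain ⟨μ, hp, hl, hs, -, hst, hE, hε⟩ := hN d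
  exact ⟨μ, hp, hl, hs, hst, hE, hε⟩

/-- **`¬ UniformResolution` unfolded.** A refutation must EXHIBIT an admissible force `f`, positive
`ν_j → 0` and budgets with loud `d`-stationary level-`N` families at every `j` (i.e. prove a `d`-wise
Galerkin-ensemble zeroth law for `f`), AND prove that for every pair of budgets `E'`, `ε' > 0` some
viscosity `ν_j` carries NO resolved loud family. [folklore] -/
theorem not_uniformResolution_iff :
    ¬ UniformResolution ↔ ∃ f : UnitAddTorus (Fin 3) → EuclideanSpace ℝ (Fin 3),
      Torus.IsSmooth f ∧ Torus.IsDivFree f ∧ Torus.HasZeroMean f ∧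
      ∃ (ν : ℕ → ℝ) (E ε : ℝ), (∀ j, 0 < ν j) ∧ Tendsto ν atTop (𝓝 0) ∧ 0 < ε ∧
      (∀ j : ℕ, IsLoudFamilyAt f (ν j) E ε) ∧
      ∀ E' ε' : ℝ, 0 < ε' → ∃ j : ℕ, ¬ IsResolvedLoudFamilyAt f (ν j) E' ε' := by
  rw [uniformResolution_iff]
  push Not
  rfl

/-- **d-WISE GALERKIN-INVARIANT LOUDNESS**: the antecedent of `UniformResolution` holds for SOME admissible
force, positive `ν_j → 0` and budgets `E`, `ε > 0`. This is `GalerkinInvariantLoud` with the invariant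
measure allowed to depend on the moment order `d` (weaker), i.e. a Galerkin-ensemble zeroth law. -/
def DwiseGalerkinInvariantLoud : Prop :=
  ∃ f : UnitAddTorus (Fin 3) → EuclideanSpace ℝ (Fin 3),
    Torus.IsSmooth f ∧ Torus.IsDivFree f ∧ Torus.HasZeroMean f ∧
    ∃ (ν : ℕ → ℝ) (E ε : ℝ), (∀ j, 0 < ν j) ∧ Tendsto ν atTop (𝓝 0) ∧ 0 < ε ∧
    ∀ j : ℕ, IsLoudFamilyAt f (ν j) E ε

/-- **Any disproof of `UniformResolution` proves a Galerkin-ensemble zeroth law** (`d`-wise form).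
Contrapositive: if `DwiseGalerkinInvariantLoud` fails (uniform laminarisation of every bounded-energy
level-`N` `d`-stationary family, for every force), `UniformResolution` holds VACUOUSLY. [folklore] -/
theorem dwise_of_not_uniformResolution (h : ¬ UniformResolution) : DwiseGalerkinInvariantLoud := by
  obtain ⟨f, hfs, hfd, hfz, ν, E, ε, hν, hν0, hε, hloud, -⟩ := not_uniformResolution_iff.1 h
  exact ⟨f, hfs, hfd, hfz, ν, E, ε, hν, hν0, hε, hloud⟩

/-- The route's crux `GalerkinInvariantLoud` (one invariant law for all orders) implies the `d`-wise
form (use the same law at every `d`). [folklore] -/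
theorem dwise_of_galerkinInvariantLoud (h : GalerkinInvariantLoud) : DwiseGalerkinInvariantLoud := by
  obtain ⟨f, hfs, hfd, hfz, ν, E, ε, hν, hν0, hε, hj⟩ := h
  refine ⟨f, hfs, hfd, hfz, ν, E, ε, hν, hν0, hε, fun j => ?_⟩
  obtain ⟨R, hfreq⟩ := hj j
  refine ⟨R, hfreq.mono ?_⟩
  rintro N ⟨μ, hp, hl, hs, hst, hE, hD⟩ d
  exact ⟨μ, hp, hl, hs, fun m g P hg _ => hst m g P hg, hE, hD⟩

end Shape

/-! ## B. The force floor; the zero force is quiet; the antecedent is load-bearing -/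

section ForceFloor

/-- Bounded support on a finite measure gives finite mean energy. [folklore] -/
theorem integrable_norm_sq_of_ae_norm_le {μ : Measure (Torus.energySpace (Fin 3))} [IsFiniteMeasure μ]
    {R : ℝ} (h : ∀ᵐ u ∂μ, ‖u‖ ≤ R) :
    Integrable (fun u : Torus.energySpace (Fin 3) => ‖u‖ ^ 2) μ := by
  refine Integrable.mono' (integrable_const (R ^ 2)) (continuous_norm.pow 2).aestronglyMeasurable
    (h.mono fun u hu => ?_)
  rw [Real.norm_eq_abs, abs_of_nonneg (by positivity)]
  exact pow_le_pow_left₀ (norm_nonneg _) hu 2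

/-- **FORCE FLOOR for the antecedent**: `ε ≤ ‖f‖_{L²} √E` for every loud `d`-stationary family
(energy row at `d = 3`; `QuarticGate.Negative.ensembleDissipation_le_of_polyStationary`). [folklore] -/
theorem IsLoudFamilyAt.eps_le_force {f : UnitAddTorus (Fin 3) → EuclideanSpace ℝ (Fin 3)}
    (hf : MemLp f 2 volume) {ν E ε : ℝ} (h : IsLoudFamilyAt f ν E ε) :
    ε ≤ Real.sqrt (∫ x, ‖f x‖ ^ 2) * Real.sqrt E := by
  obtain ⟨R, hfreq⟩ := h
  obtain ⟨N, hN⟩ := hfreq.exists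
  obtain ⟨μ, hprob, hlev, hsupp, hstat, hE, hε⟩ := hN 3
  have h2 := integrable_norm_sq_of_ae_norm_le hsupp
  calc ε ≤ Torus.ensembleDissipation ν μ := hε
    _ ≤ Real.sqrt (∫ x, ‖f x‖ ^ 2) * Real.sqrt (Torus.ensembleEnergy μ) :=
        ensembleDissipation_le_of_polyStationary f hf hlev h2 le_rfl hstat
    _ ≤ Real.sqrt (∫ x, ‖f x‖ ^ 2) * Real.sqrt E := by gcongr

/-- The same floor for the conclusion body. [folklore] -/
theorem IsResolvedLoudFamilyAt.eps_le_force {f : UnitAddTorus (Fin 3) → EuclideanSpace ℝ (Fin 3)}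
    (hf : MemLp f 2 volume) {ν E ε : ℝ} (h : IsResolvedLoudFamilyAt f ν E ε) :
    ε ≤ Real.sqrt (∫ x, ‖f x‖ ^ 2) * Real.sqrt E :=
  h.isLoudFamilyAt.eps_le_force hf

/-- **THE ZERO FORCE IS QUIET**: no loud `d`-stationary family exists for `f = 0` (any `ν`, any `E`,
`ε > 0`): the energy row at `d = 3` gives `ε ≤ 0`. [folklore] -/
theorem not_isLoudFamilyAt_zero_force {ν E ε : ℝ} (hε : 0 < ε) :
    ¬ IsLoudFamilyAt (fun _ => 0) ν E ε := fun h => by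
  have := h.eps_le_force (memLp_const 0)
  simp at this
  linarith

/-- … nor a resolved one. [folklore] -/
theorem not_isResolvedLoudFamilyAt_zero_force {ν E ε : ℝ} (hε : 0 < ε) :
    ¬ IsResolvedLoudFamilyAt (fun _ => 0) ν E ε := fun h =>
  not_isLoudFamilyAt_zero_force hε h.isLoudFamilyAt

/-- **Loudness forces positive viscosity**: the clause `∀ j, 0 < ν j` of `UniformResolution` is
REDUNDANT given `0 < ε` and the antecedent (`ε ≤ ν · toReal(…)`). [folklore] -/
theorem IsLoudFamilyAt.nu_pos {f : UnitAddTorus (Fin 3) → EuclideanSpace ℝ (Fin 3)} {ν E ε : ℝ}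
    (h : IsLoudFamilyAt f ν E ε) (hε : 0 < ε) : 0 < ν := by
  obtain ⟨R, hfreq⟩ := h
  obtain ⟨N, hN⟩ := hfreq.exists
  obtain ⟨μ, -, -, -, -, -, hεle⟩ := hN 0
  by_contra hν
  push Not at hν
  unfold Torus.ensembleDissipation at hεle
  nlinarith [ENNReal.toReal_nonneg (a := Torus.ensembleEnstrophy μ)]

/-- NATURAL STRENGTHENING 1 (refuted): the conclusion for EVERY admissible force and every positive
`ν_j → 0`, i.e. `UniformResolution` with its antecedent deleted (= `MomentLadder`'s body universally). -/
def ResolvedLoudEveryForce : Prop :=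
  ∀ f : UnitAddTorus (Fin 3) → EuclideanSpace ℝ (Fin 3),
    Torus.IsSmooth f → Torus.IsDivFree f → Torus.HasZeroMean f →
    ∀ ν : ℕ → ℝ, (∀ j, 0 < ν j) → Tendsto ν atTop (𝓝 0) →
    ∃ E' ε' : ℝ, 0 < ε' ∧ ∀ j : ℕ, IsResolvedLoudFamilyAt f (ν j) E' ε'

/-- **`¬ ResolvedLoudEveryForce`**: the antecedent of `UniformResolution` IS load-bearing — at `f = 0`
the conclusion fails for every `E'`, `ε' > 0` (energy row). [folklore] -/
theorem not_resolvedLoudEveryForce : ¬ ResolvedLoudEveryForce := fun h => by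
  obtain ⟨E', ε', hε', hj⟩ := h (fun _ => 0) (Torus.isSmooth_const _)
    (CubicParityLoud.Negative.isDivFree_const 0) (by simp [Torus.HasZeroMean])
    (fun j => 1 / ((j : ℝ) + 1)) (fun j => by positivity) tendsto_one_div_add_atTop_nhds_zero_nat
  exact not_isResolvedLoudFamilyAt_zero_force hε' (hj 0)

end ForceFloor


end

end Summit.AnomalousDissipation.AnomalousDissipation.Theorems.UniformResolution.Negative
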